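/-
VALUE = DECIDABLE VERDICT at p = 17 (one compiled evaluation of the certificate of
`ReflectionClassCertificateCode`), NOT summit progress (cell b2b-lgcu-borel, gen 23); the crux item
stmt-MatrixMultiplication-14079 is untouched.
-/
import Mathlib
import Summits.MatrixMultiplication.MatrixMultiplication.Theorems.SubgroupIdentityDesigns.Negative.ReflectionClassCertificateCode

/-!
# No member contains the non-square reflections of `𝔽₁₇^m`: the twisted class `≅ PGL₂(𝔽₁₇)`

VALUE = DECIDABLE VERDICT (`p = 17`, every `ε`, every `m ≥ 3`, no TPP, no budget), NOT summit
progress; the crux item stmt-MatrixMultiplication-14079 is untouched and remains open.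

THE CLASS.  `K = ⟨R_b : b·b a non-square⟩ = {g ∈ O₃(𝔽₁₇) : det g = 1 ⇔ θ(g) a square}` (`θ` the
spinor norm): the index-`2` subgroup of `O₃(𝔽₁₇)` of order `4896` isomorphic to `PGL₂(𝔽₁₇)` that
contains neither `−1` nor a square reflection, generated by the `136` non-square reflections of
`(𝔽₁₇³, x² + y² + z²)`: the `p = 17`
instance of the `m = 3` reflection class of sign `−χ(−1)` (the non-square class, `17 ≡ 1 (mod 4)`;
`NonsquareReflections` needs `p ≡ 3 (mod 4)`, `NonsquareReflectionsFour` needs `m ≥ 4`), decided by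
the code-tagged breadth-first certificate in 222 s (the untagged one needs 1189 s, over the gate budget).

THE VERDICT.  `cert_seventeen : certP (KSP (gens ws) 17) (gens ws) false ws 3 X₀ = true`
(`native_decide`; `X₀ = (1, 1, 1)` on the sphere `Q = 3`; `ws` = the three generator words
`r_a r_b`, `r_b r_a`, `r_c` below, breadth-first depth `17`): the closure has the `4896` elements of
`K`, is closed, orthogonal with `det = ±1`, and every twisted-stabiliser orbit sum of the weight
`w(v) = χ(Q(v + X₀)) − χ(Q(v − X₀)) + 17([v = X₀] − [v = −X₀])` (`χ(−1) = 1`: no linear term)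
on the sphere vanishes while `w(X₀) = 16`.  By `ReflectionClassCertificateCode.no_design_nsq_memᵢ_of_certP`:

THEOREMS `no_design_nsq_mem₁/₂/₃_seventeen`: NO MEMBER OF A TRIPLE IN `GL_m(𝔽₁₇)`, `m ≥ 3`, CARRYING
A LEVEL-ONE IDENTITY DESIGN CONTAINS ALL NON-SQUARE REFLECTIONS OF `𝔽₁₇^m`.  With the files
for `p ≤ 13`: for `p ∈ {3, 5, 7, 11, 13, 17}` no member contains all reflections of either square
class of `𝔽_p^m`, `m ≥ 3`; the open instances are `m = 3`, `p ≥ 19`, class of sign `−χ(−1)`.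

HONEST SCOPE.  Configuration exclusion at `p = 17`; no `(p,m,ε)` cell is emptied.
-/

set_option linter.dupNamespace false

open scoped BigOperators Matrix

namespace Summit.MatrixMultiplication.MatrixMultiplication.Theorems.SubgroupIdentityDesigns.Negative
namespace NonsquareReflectionsSeventeen

open Summit.MatrixMultiplication.MatrixMultiplication.Theorems.LieRankDesigns.Negative (GLm Mat)
open NonsquareReflections (refl)
open ReflectionClassCertificate (V)
open ReflectionClassCertificateBFS (gens)
open ReflectionClassCertificateCode (KSP certP no_design_nsq_mem₁_of_certP no_design_nsq_mem₂_of_certP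
  no_design_nsq_mem₃_of_certP)

/-- `17` is prime (instance for the level vocabulary at `p = 17`). -/
instance fact_prime_seventeen : Fact (Nat.Prime 17) := ⟨by norm_num⟩

/-- The base point `X₀ = (1, 1, 1)` of the sphere `Q = 3` in `𝔽₁₇³`. -/
def X₀ : V 17 := ![1, 1, 1]

/-- The generator words: `r_a r_b`, its inverse `r_b r_a`, and one reflection `r_c` (all three
vectors have `b·b` a non-square mod `17`). -/
def ws : List (List (V 17)) :=
  [[![1, 11, 6], ![1, 6, 11]], [![1, 6, 11], ![1, 11, 6]], [![1, 12, 11]]]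

/-- **THE CERTIFICATE OF THE NON-SQUARE CLASS AT `p = 17`, EVALUATED.** -/
theorem cert_seventeen : certP (KSP (gens ws) 17) (gens ws) false ws 3 X₀ = true := by
  native_decide

variable {m : ℕ} {H₁ H₂ H₃ : Subgroup (GLm 17 m)}

/-- **NO MEMBER OF A TRIPLE IN `GL_m(𝔽₁₇)`, `m ≥ 3`, WITH A LEVEL-ONE IDENTITY DESIGN CONTAINS ALL
NON-SQUARE REFLECTIONS OF `𝔽₁₇^m`**: member `1`. -/
theorem no_design_nsq_mem₁_seventeen (hm : 3 ≤ m)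
    (h₁ : ∀ b : Fin m → ZMod 17, ¬ IsSquare (b ⬝ᵥ b) → refl b ∈ H₁) :
    ¬ ∃ c : Mat 17 m → ℂ, (∀ M, 1 < M.rank → c M = 0) ∧
      (∑ M, c M * ZMod.stdAddChar (Matrix.trace (M * ((1 : GLm 17 m) : Mat 17 m)))) = 1 ∧
      ∀ a ∈ H₁, ∀ b ∈ H₂, ∀ g ∈ H₃, a * b * g ≠ 1 →
        (∑ M, c M * ZMod.stdAddChar (Matrix.trace (M * ((a * b * g : GLm 17 m) : Mat 17 m)))) = 0 :=
  no_design_nsq_mem₁_of_certP cert_seventeen hm h₁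

/-- Member `2`. -/
theorem no_design_nsq_mem₂_seventeen (hm : 3 ≤ m)
    (h₂ : ∀ b : Fin m → ZMod 17, ¬ IsSquare (b ⬝ᵥ b) → refl b ∈ H₂) :
    ¬ ∃ c : Mat 17 m → ℂ, (∀ M, 1 < M.rank → c M = 0) ∧
      (∑ M, c M * ZMod.stdAddChar (Matrix.trace (M * ((1 : GLm 17 m) : Mat 17 m)))) = 1 ∧
      ∀ a ∈ H₁, ∀ b ∈ H₂, ∀ g ∈ H₃, a * b * g ≠ 1 →
        (∑ M, c M * ZMod.stdAddChar (Matrix.trace (M * ((a * b * g : GLm 17 m) : Mat 17 m)))) = 0 :=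
  no_design_nsq_mem₂_of_certP cert_seventeen hm h₂

/-- Member `3`. -/
theorem no_design_nsq_mem₃_seventeen (hm : 3 ≤ m)
    (h₃ : ∀ b : Fin m → ZMod 17, ¬ IsSquare (b ⬝ᵥ b) → refl b ∈ H₃) :
    ¬ ∃ c : Mat 17 m → ℂ, (∀ M, 1 < M.rank → c M = 0) ∧
      (∑ M, c M * ZMod.stdAddChar (Matrix.trace (M * ((1 : GLm 17 m) : Mat 17 m)))) = 1 ∧
      ∀ a ∈ H₁, ∀ b ∈ H₂, ∀ g ∈ H₃, a * b * g ≠ 1 →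
        (∑ M, c M * ZMod.stdAddChar (Matrix.trace (M * ((a * b * g : GLm 17 m) : Mat 17 m)))) = 0 :=
  no_design_nsq_mem₃_of_certP cert_seventeen hm h₃

end NonsquareReflectionsSeventeen
end Summit.MatrixMultiplication.MatrixMultiplication.Theorems.SubgroupIdentityDesigns.Negative
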